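import Mathlib
import HarnessLib
import Summits.ResolutionOfSingularities.ResolutionOfSingularities.Theorems.WildQuotientsWildQuotientResolutionToricExitRootChartPresentation
import Summits.ResolutionOfSingularities.ResolutionOfSingularities.Theorems.WildQuotientsWildQuotientResolutionToricExitRootSubstInjective
import Summits.ResolutionOfSingularities.ResolutionOfSingularities.Theorems.WildQuotientsWildQuotientResolutionJordanFourParity

/-!
# N4a (A1): the `μ₂`-vertex chart ring `(k[x][It])_{(x_a t)}` IS the weight-`0` model `E`;
# the root-chart automorphism `σ_U` and the intertwining `ψ₀ ∘ σ = σ_U ∘ ψ₀`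
(crux stmt-ResolutionOfSingularities-15640 `WildQuotients.WildQuotientResolution`, line `Sketch`;
chain w45c post-V5 width target N4a `JordanThreeTwo.jordanThreeTwo_hasResolution`
(res-L1-w45c-plan-1 NO OBJECTION 2026-08-27T14:24:34Z / 15:17:58Z), cone column of
res-L1-w45c-stub-2's PART F; the `J₃ ⊕ J₂` twin of res-L1-w45c-lead-1's (A1)
`JordanFive.exists_ringEquiv_blowupChart0_weightZero` (p538056) and of res-L1-w45c-stub-2's
`JordanFive.exists_rootChart5Equiv` / `aeval_root5_comp_eq` (p537251). [OURS · L1 W4.5c] — NOT a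
statement of any manuscript; replaces the role of no printed item. Def-free.)

SETTING. `I = (x_a, x_b², x_bx_d, x_d²)` (spelling of record `![X a, X b ^ 2, X b * X d, X d ^ 2]`),
the cone chart `V[x_a]` of `Bl_I 𝔸ⁿ` with chart ring `chartRing g4 0 = (k[x][It])_{(x_a t)} =
k[x][I/x_a]`; `k[x]` doubles as the ROOT CHART `k[u, b, x_c, f, x_e, …]` (slots `u = X a`,
`b = X b`, `f = X d`) under the root substitution `ψ₀ : x_a ↦ u², x_b ↦ ub, x_d ↦ uf` (res-L1-w45c-stub-2's
`r₃₂`, p541527).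

* `exists_ringEquiv_chartRingA_weightZero` — **(A1)**: for ANY subalgebra `E ⊆ k[x]` that is the
  weight-`0` part of a `μ₂`-weight `w : Fin n → ZMod 2` with `w(a,b,d) = (1,1,1)`, `0` elsewhere,
  an isomorphism `eE : chartRing g4 0 ≃+* E` with `eE (F/1) = ψ₀ F` and
  `eE ((g_jt)/(x_at)) = q_j`, `q = ![1, x_b², x_bx_d, x_d²]` (engine
  `ToricExit.nonempty_chartRing_ringEquiv_adjoin_of_rootData`, p489374; `E = adjoin (evenGens a b d)`
  by `JordanFour.mem_adjoin_evenGens_iff`, p49xxxx).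
* `exists_rootChart32Equiv` — the root-chart automorphism `σ_U`: `b ↦ b + u`, `x_c ↦ x_c + ub`,
  `x_e ↦ x_e + uf`, every other variable fixed (the letters `hUb hUc hUe hσU` of p541527).
* `aeval_root32_comp_eq` — `ψ₀ ∘ σ = σ_U ∘ ψ₀` for the `J₃ ⊕ J₂` law `σ` and `σ_U`.
-/

-- single-problem summit: the doubled namespace component `ResolutionOfSingularities` is forced
set_option linter.dupNamespace false

noncomputable section

open MvPolynomial Literature.AlgebraicGeometry.Resolution

namespace Summit.ResolutionOfSingularities.ResolutionOfSingularities.Theorems.WildQuotientResolution.JordanThreeTwo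

variable (k : Type) [Field k] (n : ℕ) (a b c d e : Fin n)

/-- The generator vector of record (local shorthand). -/
local notation3 "g4" => (![X a, X b ^ 2, X b * X d, X d ^ 2] : Fin 4 → MvPolynomial (Fin n) k)
/-- The root substitution `ψ₀` of the `μ₂`-vertex chart (res-L1-w45c-stub-2's `r₃₂`, verbatim). -/
local notation3 "r₃₂" => (fun i : Fin n => if i = a then X a ^ 2 else if i = b then X a * X b
    else if i = d then X a * X d else (X i : MvPolynomial (Fin n) k))
/-- The chart quotients `q_j = ψ₀(g_j)/u²`. -/
local notation3 "q4" => (![1, X b ^ 2, X b * X d, X d ^ 2] : Fin 4 → MvPolynomial (Fin n) k)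

/-! ## The root substitution -/

/-- `ψ₀ (x_a) = u²`. [OURS · L1 W4.5c] -/
theorem root32_X_a : aeval r₃₂ (X a : MvPolynomial (Fin n) k) = X a ^ 2 := by
  rw [aeval_X]; simp

variable {a b} in
/-- `ψ₀ (x_b) = u b`. [OURS · L1 W4.5c] -/
theorem root32_X_b (hab : a ≠ b) : aeval r₃₂ (X b : MvPolynomial (Fin n) k) = X a * X b := by
  rw [aeval_X]; simp [hab.symm]

variable {a b d} in
/-- `ψ₀ (x_d) = u f`. [OURS · L1 W4.5c] -/
theorem root32_X_d (had : a ≠ d) (hbd : b ≠ d) :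
    aeval r₃₂ (X d : MvPolynomial (Fin n) k) = X a * X d := by
  rw [aeval_X]; simp [had.symm, hbd.symm]

variable {a b d} in
/-- `ψ₀ (x_i) = x_i` for `i ∉ {a, b, d}`. [OURS · L1 W4.5c] -/
theorem root32_X_of_ne {i : Fin n} (hia : i ≠ a) (hib : i ≠ b) (hid : i ≠ d) :
    aeval r₃₂ (X i : MvPolynomial (Fin n) k) = X i := by
  rw [aeval_X]; simp [hia, hib, hid]

variable {a b d} in
/-- `ψ₀` is the monomial twist `x_a ↦ x_a², x_s ↦ x_s · x_a^{e_s}`, `e = (b ↦ 1, d ↦ 1, else 0)`.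
[folklore] -/
theorem aeval_root32_eq_monomialTwist (hab : a ≠ b) (had : a ≠ d) (hbd : b ≠ d) :
    (aeval r₃₂ : MvPolynomial (Fin n) k →ₐ[k] MvPolynomial (Fin n) k) =
      aeval (fun s : Fin n => (if s = a then X a ^ 2 else
        X s * X a ^ ((fun s : Fin n => if s = b then 1 else if s = d then 1 else 0) s) :
          MvPolynomial (Fin n) k)) := by
  refine MvPolynomial.algHom_ext fun i => ?_
  rw [aeval_X, aeval_X]
  by_cases hia : i = a
  · subst hia; simp
  by_cases hib : i = b
  · subst hib; simp [hia]; ring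
  by_cases hid : i = d
  · subst hid; simp [hia, hib]; ring
  · simp [hia, hib, hid]

variable {a b d} in
/-- `ψ₀` is injective. [folklore] -/
theorem aeval_root32_injective (hab : a ≠ b) (had : a ≠ d) (hbd : b ≠ d) :
    Function.Injective (aeval r₃₂ : MvPolynomial (Fin n) k →ₐ[k] MvPolynomial (Fin n) k) := by
  rw [aeval_root32_eq_monomialTwist k n hab had hbd]
  exact ToricExit.monomialTwist_injective k n a 2 (by norm_num) _

variable {a b d} in
/-- The chart quotients: `ψ₀ (g_j) = q_j · ψ₀ (x_a)`, `q = (1, x_b², x_bx_d, x_d²)`. [folklore] -/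
theorem aeval_root32_gens (hab : a ≠ b) (had : a ≠ d) (hbd : b ≠ d) (j : Fin 4) :
    aeval r₃₂ (g4 j) = q4 j * aeval r₃₂ (g4 0) := by
  have hra := root32_X_a k n a b d
  have hrb := root32_X_b k n (d := d) hab
  have hrd := root32_X_d k n had hbd
  fin_cases j
  · simp only [Matrix.cons_val_zero, Fin.zero_eta, one_mul]
  · simp only [Fin.mk_one, Matrix.cons_val_one, Matrix.cons_val_zero, map_pow, hrb, hra]; ring
  · simp only [Fin.reduceFinMk, Matrix.cons_val, map_mul, hrb, hrd, Matrix.cons_val_zero, hra]; ring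
  · simp only [Fin.reduceFinMk, Matrix.cons_val, map_pow, hrd, Matrix.cons_val_zero, hra]; ring

/-! ## (A1): the chart ring is the weight-`0` model -/

variable {a b d} in
set_option maxHeartbeats 800000 in
/-- **(A1) `(k[x][It])_{(x_a t)} ≅ E`** for `I = (x_a, x_b², x_bx_d, x_d²)` and ANY subalgebra
`E ⊆ k[x]` that is the weight-`0` part of a `μ₂`-weight `w` with `w(a,b,d) = (1,1,1)`, `0` elsewhere:
`eE : chartRing g4 0 ≃+* E` with `eE (F/1) = ψ₀ F` and `eE ((g_jt)/(x_at)) = q_j`.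
[OURS · L1 W4.5c] [folklore; assembly of landed decls] -/
theorem exists_ringEquiv_chartRingA_weightZero (hab : a ≠ b) (had : a ≠ d) (hbd : b ≠ d)
    (w : Fin n → ZMod 2) (hwa : w a = 1) (hwb : w b = 1) (hwd : w d = 1)
    (hw0 : ∀ i, i ≠ a → i ≠ b → i ≠ d → w i = 0)
    (E : Subalgebra k (MvPolynomial (Fin n) k)) (hE : ∀ f, f ∈ E ↔ IsWeightedHomogeneous w f 0) :
    ∃ eE : chartRing g4 0 ≃+* ↥E,
      (∀ F : MvPolynomial (Fin n) k,
        ((eE (chartBase g4 0 F) : ↥E) : MvPolynomial (Fin n) k) = aeval r₃₂ F) ∧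
      ∀ j : Fin 4, ((eE (chartGen g4 0 j) : ↥E) : MvPolynomial (Fin n) k) = q4 j := by
  classical
  let ψ₀ : MvPolynomial (Fin n) k →ₐ[k] MvPolynomial (Fin n) k := aeval r₃₂
  have hinj : Function.Injective ψ₀ := aeval_root32_injective k n hab had hbd
  have hg0 : g4 0 = X a := rfl
  have hψa : ψ₀ (X a) = X a ^ 2 := root32_X_a k n a b d
  have hψb : ψ₀ (X b) = X a * X b := root32_X_b k n (d := d) hab
  have hψd : ψ₀ (X d) = X a * X d := root32_X_d k n had hbd
  have hunit : ψ₀ (g4 0) * 1 = g4 0 ^ 2 := by rw [hg0, hψa, mul_one]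
  have hq : ∀ j : Fin 4, ψ₀ (g4 j) = q4 j * ψ₀ (g4 0) := aeval_root32_gens k n hab had hbd
  let G : Set (MvPolynomial (Fin n) k) := Set.range (fun s : Fin n => ψ₀ (X s)) ∪ Set.range q4
  obtain ⟨e₀, hbase, hgen⟩ : ∃ e₀ : chartRing g4 0 ≃+* ↥(Algebra.adjoin k G),
      (∀ f : MvPolynomial (Fin n) k,
        ((e₀ (chartBase g4 0 f) : ↥(Algebra.adjoin k G)) : MvPolynomial (Fin n) k) = ψ₀ f) ∧
      ∀ j : Fin 4, ((e₀ (chartGen g4 0 j) : ↥(Algebra.adjoin k G)) : MvPolynomial (Fin n) k) = q4 j :=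
    ToricExit.nonempty_chartRing_ringEquiv_adjoin_of_rootData k g4 0
      (by rw [hg0]; exact X_ne_zero a) ψ₀ hinj 1 2 hunit q4 hq
  -- `adjoin k G = adjoin k (evenGens a b d) = E`
  have hψX : ∀ s, ψ₀ (X s) ∈ Algebra.adjoin k G := fun s => Algebra.subset_adjoin (Or.inl ⟨s, rfl⟩)
  have hqG : ∀ j, q4 j ∈ Algebra.adjoin k G := fun j => Algebra.subset_adjoin (Or.inr ⟨j, rfl⟩)
  have hGE : Algebra.adjoin k G ≤ Algebra.adjoin k (JordanFour.evenGens k n a b d) := by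
    refine Algebra.adjoin_le ?_
    rintro g (⟨s, rfl⟩ | ⟨j, rfl⟩)
    · change ψ₀ (X s) ∈ Algebra.adjoin k (JordanFour.evenGens k n a b d)
      by_cases hsa : s = a
      · rw [hsa, hψa]; exact Algebra.subset_adjoin (Or.inl (by simp))
      by_cases hsb : s = b
      · rw [hsb, hψb]; exact Algebra.subset_adjoin (Or.inl (by simp))
      by_cases hsd : s = d
      · rw [hsd, hψd]; exact Algebra.subset_adjoin (Or.inl (by simp))
      · rw [show ψ₀ (X s) = X s from root32_X_of_ne k n hsa hsb hsd]
        exact Algebra.subset_adjoin (Or.inr ⟨s, ⟨hsa, hsb, hsd⟩, rfl⟩)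
    · change q4 j ∈ Algebra.adjoin k (JordanFour.evenGens k n a b d)
      fin_cases j
      · exact Subalgebra.one_mem _
      · exact Algebra.subset_adjoin (Or.inl (by simp))
      · exact Algebra.subset_adjoin (Or.inl (by simp))
      · exact Algebra.subset_adjoin (Or.inl (by simp))
  have hEG : Algebra.adjoin k (JordanFour.evenGens k n a b d) ≤ Algebra.adjoin k G := by
    refine Algebra.adjoin_le ?_
    rintro g (hg | ⟨i, ⟨hia, hib, hid⟩, rfl⟩)
    · simp only [Set.mem_insert_iff, Set.mem_singleton_iff] at hg
      rcases hg with rfl | rfl | rfl | rfl | rfl | rfl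
      · exact hψa ▸ hψX a
      · exact hψb ▸ hψX b
      · exact hψd ▸ hψX d
      · exact hqG 1
      · exact hqG 2
      · exact hqG 3
    · change (X i : MvPolynomial (Fin n) k) ∈ Algebra.adjoin k G
      exact (root32_X_of_ne k n hia hib hid) ▸ hψX i
  have hEq : Algebra.adjoin k G = E := by
    apply le_antisymm
    · intro f hf
      exact (hE f).mpr ((JordanFour.mem_adjoin_evenGens_iff k n a b d hab had hbd w hwa hwb hwd hw0 f).mp
        (hGE hf))
    · intro f hf
      exact hEG ((JordanFour.mem_adjoin_evenGens_iff k n a b d hab had hbd w hwa hwb hwd hw0 f).mpr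
        ((hE f).mp hf))
  refine ⟨e₀.trans (Subalgebra.equivOfEq _ _ hEq).toRingEquiv, fun F => ?_, fun j => ?_⟩
  · change ((Subalgebra.equivOfEq _ _ hEq (e₀ (chartBase g4 0 F)) : ↥E) : MvPolynomial (Fin n) k) = _
    exact hbase F
  · change ((Subalgebra.equivOfEq _ _ hEq (e₀ (chartGen g4 0 j)) : ↥E) : MvPolynomial (Fin n) k) = _
    exact hgen j

/-! ## The root-chart automorphism `σ_U` and the intertwining -/

variable (hab : a ≠ b) (hac : a ≠ c) (had : a ≠ d) (hae : a ≠ e) (hbc : b ≠ c) (hbd : b ≠ d)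
  (hbe : b ≠ e) (hcd : c ≠ d) (hce : c ≠ e) (hde : d ≠ e)

include hab hac hae hbc hbd hbe hcd hce hde in
/-- **The root-chart automorphism exists** (`μ₂` vertex chart of `J₃ ⊕ J₂`): `σ_U b = b + u`,
`σ_U x_c = x_c + ub`, `σ_U x_e = x_e + uf`, `σ_U x_i = x_i` otherwise (`u = X a`, `b = X b`,
`f = X d`); inverse `b ↦ b − u`, `x_c ↦ x_c − ub + u²`, `x_e ↦ x_e − uf`. [OURS · L1 W4.5c] [folklore] -/
theorem exists_rootChart32Equiv :
    ∃ σU : MvPolynomial (Fin n) k ≃ₐ[k] MvPolynomial (Fin n) k,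
      σU (X b) = X b + X a ∧ σU (X c) = X c + X a * X b ∧ σU (X e) = X e + X a * X d ∧
        ∀ i, i ≠ b → i ≠ c → i ≠ e → σU (X i) = X i := by
  classical
  let φ : MvPolynomial (Fin n) k →ₐ[k] MvPolynomial (Fin n) k :=
    aeval fun i => if i = b then X b + X a else if i = c then X c + X a * X b
      else if i = e then X e + X a * X d else X i
  let φ' : MvPolynomial (Fin n) k →ₐ[k] MvPolynomial (Fin n) k :=
    aeval fun i => if i = b then X b - X a else if i = c then X c - X a * X b + X a ^ 2
      else if i = e then X e - X a * X d else X i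
  have hφa : φ (X a) = X a := by change aeval _ (X a) = _; rw [aeval_X]; simp [hab, hac, hae]
  have hφb : φ (X b) = X b + X a := by change aeval _ (X b) = _; rw [aeval_X]; simp
  have hφc : φ (X c) = X c + X a * X b := by
    change aeval _ (X c) = _; rw [aeval_X]; simp [hbc.symm]
  have hφd : φ (X d) = X d := by
    change aeval _ (X d) = _; rw [aeval_X]; simp [hbd.symm, hcd.symm, hde]
  have hφe : φ (X e) = X e + X a * X d := by
    change aeval _ (X e) = _; rw [aeval_X]; simp [hbe.symm, hce.symm]
  have hφi : ∀ i, i ≠ b → i ≠ c → i ≠ e → φ (X i) = X i := fun i h1 h2 h3 => by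
    change aeval _ (X i) = _; rw [aeval_X]; simp [h1, h2, h3]
  have hφ'a : φ' (X a) = X a := by change aeval _ (X a) = _; rw [aeval_X]; simp [hab, hac, hae]
  have hφ'b : φ' (X b) = X b - X a := by change aeval _ (X b) = _; rw [aeval_X]; simp
  have hφ'c : φ' (X c) = X c - X a * X b + X a ^ 2 := by
    change aeval _ (X c) = _; rw [aeval_X]; simp [hbc.symm]
  have hφ'd : φ' (X d) = X d := by
    change aeval _ (X d) = _; rw [aeval_X]; simp [hbd.symm, hcd.symm, hde]
  have hφ'e : φ' (X e) = X e - X a * X d := by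
    change aeval _ (X e) = _; rw [aeval_X]; simp [hbe.symm, hce.symm]
  have hφ'i : ∀ i, i ≠ b → i ≠ c → i ≠ e → φ' (X i) = X i := fun i h1 h2 h3 => by
    change aeval _ (X i) = _; rw [aeval_X]; simp [h1, h2, h3]
  have h₁ : φ.comp φ' = AlgHom.id k (MvPolynomial (Fin n) k) := by
    refine MvPolynomial.algHom_ext fun i => ?_
    rw [AlgHom.comp_apply, AlgHom.id_apply]
    by_cases hib : i = b
    · rw [hib, hφ'b, map_sub, hφb, hφa]; ring
    by_cases hic : i = c
    · rw [hic, hφ'c, map_add, map_sub, map_mul, map_pow, hφc, hφa, hφb]; ring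
    by_cases hie : i = e
    · rw [hie, hφ'e, map_sub, map_mul, hφe, hφa, hφd]; ring
    · rw [hφ'i i hib hic hie, hφi i hib hic hie]
  have h₂ : φ'.comp φ = AlgHom.id k (MvPolynomial (Fin n) k) := by
    refine MvPolynomial.algHom_ext fun i => ?_
    rw [AlgHom.comp_apply, AlgHom.id_apply]
    by_cases hib : i = b
    · rw [hib, hφb, map_add, hφ'b, hφ'a]; ring
    by_cases hic : i = c
    · rw [hic, hφc, map_add, map_mul, hφ'c, hφ'a, hφ'b]; ring
    by_cases hie : i = e
    · rw [hie, hφe, map_add, map_mul, hφ'e, hφ'a, hφ'd]; ring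
    · rw [hφi i hib hic hie, hφ'i i hib hic hie]
  exact ⟨AlgEquiv.ofAlgHom φ φ' h₁ h₂, hφb, hφc, hφe, fun i h1 h2 h3 => hφi i h1 h2 h3⟩

include hab hac had hae hbc hbd hbe hcd hde in
/-- **`ψ₀ ∘ σ = σ_U ∘ ψ₀`**: the root substitution of the `μ₂`-vertex chart intertwines the
`J₃ ⊕ J₂` automorphism `σ` (`x_b ↦ x_b + x_a`, `x_c ↦ x_c + x_b`, `x_e ↦ x_e + x_d`, rest fixed) with
the root-chart automorphism `σ_U`; both given by their laws. [OURS · L1 W4.5c] [folklore] -/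
theorem aeval_root32_comp_eq (σ σU : MvPolynomial (Fin n) k ≃ₐ[k] MvPolynomial (Fin n) k)
    (hb : σ (X b) = X b + X a) (hc : σ (X c) = X c + X b) (he : σ (X e) = X e + X d)
    (hσ : ∀ i, i ≠ b → i ≠ c → i ≠ e → σ (X i) = X i)
    (hUb : σU (X b) = X b + X a) (hUc : σU (X c) = X c + X a * X b)
    (hUe : σU (X e) = X e + X a * X d) (hσU : ∀ i, i ≠ b → i ≠ c → i ≠ e → σU (X i) = X i) :
    (aeval r₃₂).comp (σ : MvPolynomial (Fin n) k →ₐ[k] MvPolynomial (Fin n) k) =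
      (σU : MvPolynomial (Fin n) k →ₐ[k] MvPolynomial (Fin n) k).comp (aeval r₃₂) := by
  have ha : σ (X a) = X a := hσ a hab hac hae
  have hd : σ (X d) = X d := hσ d (Ne.symm hbd) (Ne.symm hcd) hde
  have hUa : σU (X a) = X a := hσU a hab hac hae
  have hUd : σU (X d) = X d := hσU d (Ne.symm hbd) (Ne.symm hcd) hde
  have hra := root32_X_a k n a b d
  have hrb := root32_X_b k n (d := d) hab
  have hrd := root32_X_d k n had hbd
  have hrc : aeval r₃₂ (X c : MvPolynomial (Fin n) k) = X c :=
    root32_X_of_ne k n (Ne.symm hac) (Ne.symm hbc) hcd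
  have hre : aeval r₃₂ (X e : MvPolynomial (Fin n) k) = X e :=
    root32_X_of_ne k n (Ne.symm hae) (Ne.symm hbe) (Ne.symm hde)
  refine MvPolynomial.algHom_ext fun i => ?_
  simp only [AlgHom.comp_apply, AlgEquiv.coe_toAlgHom]
  by_cases hib : i = b
  · rw [hib, hb, map_add, hrb, hra, map_mul, hUb, hUa]; ring
  by_cases hic : i = c
  · rw [hic, hc, map_add, hrc, hrb, hUc]
  by_cases hie : i = e
  · rw [hie, he, map_add, hre, hrd, hUe]
  by_cases hia : i = a
  · rw [hia, ha, hra, map_pow, hUa]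
  by_cases hid : i = d
  · rw [hid, hd, hrd, map_mul, hUa, hUd]
  · rw [hσ i hib hic hie, root32_X_of_ne k n hia hib hid, hσU i hib hic hie]

end Summit.ResolutionOfSingularities.ResolutionOfSingularities.Theorems.WildQuotientResolution.JordanThreeTwo

end
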